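import Mathlib
import HarnessLib
import Literature.MathematicalPhysics.QuantumFieldTheory.WilsonPlaquetteWeakCouplingFloor
import Summits.Ventures.LatticeQCDFlow.Scaling.AutoregressiveGaugePlaquetteMarginal

/-!
# LatticeQCDFlow / Scaling — Chebyshev for the plaquette small ball: a plaquette floor
# `w ≤ ⟨(1/N) Re tr U_p⟩_β` gives `π_β{‖ρ(U_p) − 1‖ ≤ ε} ≥ 1 − 2N(1 − w)/ε²` for every `ε > 0`

HONEST FRAMING: exact (Metropolis-corrected) sampling algorithms for lattice gauge theory;
figures of merit are autocorrelation/cost numbers at stated couplings and volumes; no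
continuum-physics claim.

Venture `LatticeQCDFlow` (cell pub-lqcd), topic `Scaling`, FANOUT row 30 (lean-1, GEN-21) — OUR WORK on
THEORY-2.md §4 row C5: the one step that turns the tree's plaquette-MEAN floors (volume-uniform at weak
coupling, `Literature/…/WilsonPlaquetteWeakCouplingFloor`; explicit for `SU(2)`/`SU(3)`) into floors on the
Wilson MASS of the small ball `B_ε = {‖ρ(g) − 1‖ ≤ ε}` around the identity, which is what the small-ball and
logarithmic per-link floors (`Scaling/AutoregressiveGaugeAcceptanceCeilingHalf`,
`Scaling/AutoregressiveGaugeStepKLLogFloor`) consume: for unitary `ρ`, `‖ρ(g) − 1‖² = 2(N − Re tr ρ(g))`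
(tree `sub_re_trace_eq_half_norm_sub_one_sq`), so `𝟙_{B_ε} ≥ 1 − 2(N − Re tr ρ)/ε²` pointwise.

## What is proved ([ours])

* **`wilson_ball_mass_ge_of_floor`** — unitary continuous `ρ`, `N ≥ 1`, any real `β`, `ε > 0`, plaquette
  `p`, `w ≤ ⟨(1/N) Re tr ρ(U_p)⟩_β`:  `1 − 2N(1 − w)/ε² ≤ (1/Z)∫ 𝟙_{B_ε}(U_p)·e^{−βS_W} dπ`.

No `def`, no `sorry`, nothing cited as a fact beyond the tree.
-/

noncomputable section

namespace Summit.Ventures.LatticeQCDFlow.Theory2.Autoregressive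

open MeasureTheory Function Set
open Literature.MathematicalPhysics.QuantumFieldTheory Literature.MathematicalPhysics.QuantumLattice
open Summit.Ventures.LatticeQCDFlow.Exactness
open scoped Matrix Matrix.Norms.Frobenius

variable {d L N : ℕ} {G : Type*} [Group G] [TopologicalSpace G] [IsTopologicalGroup G]
  [CompactSpace G] [SecondCountableTopology G] [MeasurableSpace G] [BorelSpace G] [NeZero L]
  (ρ : G →* Matrix (Fin N) (Fin N) ℂ)

/-- **The Wilson mass of the small ball from a plaquette floor** (unitary `ρ`, `N ≥ 1`, `ε > 0`):
`𝟙_{B_ε}(g) ≥ 1 − ‖ρ(g) − 1‖²/ε² = 1 − 2(N − Re tr ρ(g))/ε²`, hence for every `w ≤ ⟨(1/N) Re tr ρ(U_p)⟩_β`: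
`(1/Z)∫ 𝟙_{B_ε}(U_p) e^{−βS_W} dπ ≥ 1 − 2N(1 − w)/ε²`. [ours] -/
theorem wilson_ball_mass_ge_of_floor (hN : 1 ≤ N) (hρ : Continuous ρ)
    (hρU : ∀ g, ρ g ∈ Matrix.unitaryGroup (Fin N) ℂ) (β : ℝ) {ε : ℝ} (hε : 0 < ε)
    (p : Plaquette d L) {w : ℝ} (hw : w ≤ wilsonExpectation ρ β
      (fun U : GaugeConfig d L G => (N : ℝ)⁻¹ * (ρ (plaquetteHolonomy U p.1 p.2.1.1 p.2.1.2)).trace.re)) :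
    1 - 2 * N * (1 - w) / ε ^ 2 ≤
      (∫ U, Set.indicator {g : G | ‖ρ g - 1‖ ≤ ε} (1 : G → ℝ)
            (plaquetteHolonomy U p.1 p.2.1.1 p.2.1.2) * Real.exp (-β * wilsonAction ρ U)
          ∂Measure.pi (fun _ : Edge d L => haarProbability G)) /
        ∫ W, Real.exp (-β * wilsonAction ρ W) ∂Measure.pi (fun _ : Edge d L => haarProbability G) := by
  classical
  set μ := haarProbability G with hμ
  set π := Measure.pi (fun _ : Edge d L => μ) with hπ
  set F : GaugeConfig d L G → ℝ := fun U => Real.exp (-β * wilsonAction ρ U) with hF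
  set S : Set G := {g : G | ‖ρ g - 1‖ ≤ ε} with hS
  have hSm : MeasurableSet S :=
    (isClosed_le ((hρ.sub continuous_const).norm) continuous_const).measurableSet
  set H : G → ℝ := S.indicator (1 : G → ℝ) with hH
  have hHm : Measurable H := measurable_const.indicator hSm
  set Z : ℝ := ∫ W, F W ∂π with hZ
  set R : GaugeConfig d L G → ℝ := fun U => (ρ (plaquetteHolonomy U p.1 p.2.1.1 p.2.1.2)).trace.re
    with hR
  obtain ⟨hFm, B, hFlo, hFhi⟩ := wilsonWeight_props (d := d) (L := L) ρ hρ β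
  have hF0 : ∀ U : GaugeConfig d L G, 0 ≤ F U := fun U => (Real.exp_pos _).le
  have hFabs : ∀ U : GaugeConfig d L G, |F U| ≤ Real.exp (|β| * B) := fun U => by
    rw [abs_of_pos (Real.exp_pos _)]; exact hFhi U
  have hZpos : 0 < Z :=
    integral_exp_pos (Literature.Probability.LatticeModels.integrable_of_continuous_compactSpace _
      (Real.continuous_exp.comp (continuous_const.mul (continuous_wilsonAction ρ hρ))))
  have hNr : (0 : ℝ) < N := by exact_mod_cast hN
  -- pointwise: `H g ≥ 1 − 2(N − Re tr ρ g)/ε²`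
  have hpt : ∀ g : G, 1 - 2 * ((N : ℝ) - (ρ g).trace.re) / ε ^ 2 ≤ H g := by
    intro g
    have hid := sub_re_trace_eq_half_norm_sub_one_sq (hρU g)
    by_cases hg : g ∈ S
    · have hH1 : H g = 1 := by simp [hH, hg]
      rw [hH1]
      have : 0 ≤ (N : ℝ) - (ρ g).trace.re := by rw [hid]; positivity
      have : 0 ≤ 2 * ((N : ℝ) - (ρ g).trace.re) / ε ^ 2 := by positivity
      linarith
    · have hH0 : H g = 0 := by simp [hH, hg]
      rw [hH0]
      have hlt : ε < ‖ρ g - 1‖ := by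
        by_contra h
        exact hg (not_lt.1 h)
      have hsq : ε ^ 2 ≤ ‖ρ g - 1‖ ^ 2 := by
        exact pow_le_pow_left₀ hε.le hlt.le 2
      have e : 2 * ((N : ℝ) - (ρ g).trace.re) = ‖ρ g - 1‖ ^ 2 := by rw [hid]; ring
      rw [e, sub_nonpos, le_div_iff₀ (by positivity), one_mul]
      exact hsq
  -- measurability / integrability
  have hRm : Measurable R :=
    (Complex.continuous_re.comp hρ.matrix_trace).measurable.comp
      (measurable_plaquetteHolonomy p.1 p.2.1.1 p.2.1.2)
  have hRb : ∀ U : GaugeConfig d L G, |R U| ≤ (N : ℝ) := fun U => by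
    simpa [hR] using
      Literature.RepresentationTheory.CompactGroups.CompactGroup.abs_re_trace_le_card ρ hρ
        (plaquetteHolonomy U p.1 p.2.1.1 p.2.1.2)
  have hiF : Integrable F π :=
    Integrable.mono' (integrable_const _) hFm.aestronglyMeasurable
      (ae_of_all _ fun U => by rw [Real.norm_eq_abs]; exact hFabs U)
  have hiRF : Integrable (fun U => R U * F U) π :=
    Integrable.mono' (integrable_const ((N : ℝ) * Real.exp (|β| * B))) ((hRm.mul hFm).aestronglyMeasurable)
      (ae_of_all _ fun U => by
        rw [Real.norm_eq_abs, abs_mul]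
        exact mul_le_mul (hRb _) (hFabs U) (abs_nonneg _) (Nat.cast_nonneg N))
  have hHF01 : ∀ U : GaugeConfig d L G,
      0 ≤ H (plaquetteHolonomy U p.1 p.2.1.1 p.2.1.2) ∧ H (plaquetteHolonomy U p.1 p.2.1.1 p.2.1.2) ≤ 1 :=
    fun U => by
      by_cases hg : plaquetteHolonomy U p.1 p.2.1.1 p.2.1.2 ∈ S
      · simp [hH, hg]
      · simp [hH, hg]
  have hiHF : Integrable (fun U => H (plaquetteHolonomy U p.1 p.2.1.1 p.2.1.2) * F U) π :=
    Integrable.mono' (integrable_const (1 * Real.exp (|β| * B)))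
      (((hHm.comp (measurable_plaquetteHolonomy p.1 p.2.1.1 p.2.1.2)).mul hFm).aestronglyMeasurable)
      (ae_of_all _ fun U => by
        rw [Real.norm_eq_abs, abs_mul, abs_of_nonneg (hHF01 U).1]
        exact mul_le_mul (hHF01 U).2 (hFabs U) (abs_nonneg _) zero_le_one)
  -- the floor in integral form: `w Z ≤ N⁻¹ ∫ R F`
  rw [wilsonExpectation_eq_integral_div ρ hρ] at hw
  have hnum : ∫ U, (N : ℝ)⁻¹ * (ρ (plaquetteHolonomy U p.1 p.2.1.1 p.2.1.2)).trace.re *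
        Real.exp (-β * wilsonAction ρ U) ∂π = (N : ℝ)⁻¹ * ∫ U, R U * F U ∂π := by
    rw [← integral_const_mul]
    refine integral_congr_ae (ae_of_all _ fun U => ?_)
    simp only [hR, hF]
    ring
  rw [hnum] at hw
  have hw' : w * Z ≤ (N : ℝ)⁻¹ * ∫ U, R U * F U ∂π := by
    have := (le_div_iff₀ hZpos).1 hw
    linarith
  -- integrate the pointwise bound against `F ≥ 0`
  have hint : ∫ U, (1 - 2 * ((N : ℝ) - R U) / ε ^ 2) * F U ∂π ≤
      ∫ U, H (plaquetteHolonomy U p.1 p.2.1.1 p.2.1.2) * F U ∂π := by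
    have hiL : Integrable (fun U => (1 - 2 * ((N : ℝ) - R U) / ε ^ 2) * F U) π := by
      have : (fun U => (1 - 2 * ((N : ℝ) - R U) / ε ^ 2) * F U) =
          fun U => (1 - 2 * (N : ℝ) / ε ^ 2) * F U + (2 / ε ^ 2) * (R U * F U) := by
        funext U; ring
      rw [this]
      exact (hiF.const_mul _).add (hiRF.const_mul _)
    exact integral_mono hiL hiHF fun U => mul_le_mul_of_nonneg_right (hpt _) (hF0 U)
  have hlhs : ∫ U, (1 - 2 * ((N : ℝ) - R U) / ε ^ 2) * F U ∂π =
      (1 - 2 * (N : ℝ) / ε ^ 2) * Z + (2 / ε ^ 2) * ∫ U, R U * F U ∂π := by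
    have : (fun U => (1 - 2 * ((N : ℝ) - R U) / ε ^ 2) * F U) =
        fun U => (1 - 2 * (N : ℝ) / ε ^ 2) * F U + (2 / ε ^ 2) * (R U * F U) := by
      funext U; ring
    rw [this, integral_add (hiF.const_mul _) (hiRF.const_mul _), integral_const_mul, integral_const_mul]
  rw [hlhs] at hint
  -- `(1 − 2N(1−w)/ε²)·Z ≤ (1 − 2N/ε²) Z + (2/ε²)·N·(w Z) ≤ (1 − 2N/ε²) Z + (2/ε²) ∫ R F ≤ ∫ H F`
  have hε2 : 0 < ε ^ 2 := by positivity
  have hstep : (1 - 2 * N * (1 - w) / ε ^ 2) * Z ≤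
      ∫ U, H (plaquetteHolonomy U p.1 p.2.1.1 p.2.1.2) * F U ∂π := by
    have hRF : (N : ℝ) * (w * Z) ≤ ∫ U, R U * F U ∂π := by
      have := mul_le_mul_of_nonneg_left hw' hNr.le
      rwa [mul_inv_cancel_left₀ hNr.ne'] at this
    have e : (1 - 2 * N * (1 - w) / ε ^ 2) * Z =
        (1 - 2 * (N : ℝ) / ε ^ 2) * Z + (2 / ε ^ 2) * ((N : ℝ) * (w * Z)) := by
      field_simp
      ring
    rw [e]
    exact le_trans (by nlinarith [mul_le_mul_of_nonneg_left hRF (show (0 : ℝ) ≤ 2 / ε ^ 2 by positivity)])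
      hint
  rw [le_div_iff₀ hZpos]
  exact hstep

end Summit.Ventures.LatticeQCDFlow.Theory2.Autoregressive

end
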